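import Summits.CriticalPhenomena.CardyFormulaZ2.Theorems.CardyBoundaryCoulombGasBoundaryDefectGaussianRS17ConfigsNonemptyPart6
import Summits.CriticalPhenomena.CardyFormulaZ2.Theorems.CardyBoundaryCoulombGasBoundaryDefectGaussianRStubRealisabilityPart46

/-!
# Stub `s17_eventually_configsNonempty` of the D2 completion (line
# `rainbow-monomials-in-excursion-kernels`, crux `BoundaryDefectGaussianR`,
# stmt-CriticalPhenomena-14132) — Part 8: straight runs through flat insertion points; away from
# the insertion points the collar walk is silent

Notation of Parts 7, 8, 31 of the realisability stub: `ι` admissible on `V`, `ds = cycle V d₀` the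
boundary cycle from the sink's dart (length `P`), `st t` the walk state after `t` darts,
`L = sinkLegs`. A dart `t` is SILENT when `st (t + 1)` and `st t` have the same level and
wiredness, ACTIVE otherwise.

* `ca_run` — if the insertion point at the cycle dart `ds[s₀] = (x₀, k₀)` is FLAT at radius `R`
  (`V` a half-plane on the lattice ball of radius `R` about `x₀`), the cycle runs straight through
  it for `R - 2` darts in both directions: `ds[(s₀ + m) % P] = (x₀ + m • dir (k₀+1), k₀)` and
  `ds[(s₀ + P (R-2) - m) % P] = (x₀ - m • dir (k₀+1), k₀)` (`dsucc_straight` of Part 31 followed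
  along the cycle, Part 3);
* `ca_active_near` — an ACTIVE dart lies in the footprint of an insertion point (Part 41), on its
  straight run: its vertex is within sup-distance `L - 1` of an insertion point (flatness at
  radius `L + 2` suffices);
* `ca_step_le_one` — a boundary step moves the vertex by at most one (sup-norm), so
  `ds[(s + e) % P]` stays within `e` of `ds[s]` (`ca_vertex_near`);
* `ca_silent_run` — along consecutive silent darts the level and the wiredness do not change
  (across the seam included, `st_mod_succ`);
* `ca_levels_eq` — consequently, if no insertion point is within sup-distance `m + L - 1` of the
  vertex of `ds[s]`, the four states `st s`, `st (s+1)`, `st s'`, `st (s'+1)` at `s` and at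
  `s' = (s + m) % P` carry one level and one wiredness.
Registered one-line form: `s17_configsNonempty_part8` (= `ca_active_near`). All [folklore].
-/

namespace Summit.CriticalPhenomena.CardyFormulaZ2.Cruxes.BoundaryDefectGaussianR.RainbowMonomialsInExcursionKernels

open Literature.Probability.LatticeModels Literature.Probability.LatticeModels.CollarLegModel

/-! ### Straight runs through a flat insertion point -/

/-- **The straight run of the cycle through a flat point.** If the cycle dart `ds[s₀] = (x₀, k₀)`
sits at a point where `V` is a half-plane on the lattice ball of radius `R ≥ 2`, then for
`m ≤ R - 2` the darts `m` steps after and `m` steps before it (cyclically) are the straight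
translates `(x₀ ± m • dir (k₀ + 1), k₀)`. [folklore] -/
theorem ca_run {V : Finset (ℤ × ℤ)} {d₀ : Dart} (hv₀ : d₀.1 ∈ V) (ht₀ : dartTip d₀ ∉ V)
    {s₀ : ℕ} (hs₀ : s₀ < (cycle V d₀).length) {x₀ : ℤ × ℤ} {k₀ : Fin 4}
    (hds₀ : (cycle V d₀)[s₀] = (x₀, k₀)) {dvec : ℤ × ℤ} {R : ℤ}
    (hd : dvec = (1, 0) ∨ dvec = (-1, 0) ∨ dvec = (0, 1) ∨ dvec = (0, -1))
    (hflat : ∀ v : ℤ × ℤ, (v.1 - x₀.1) ^ 2 + (v.2 - x₀.2) ^ 2 ≤ R ^ 2 →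
      (v ∈ V ↔ 0 ≤ (v.1 - x₀.1) * dvec.1 + (v.2 - x₀.2) * dvec.2)) (hR : 2 ≤ R) :
    (∀ m : ℕ, (m : ℤ) ≤ R - 2 →
      (cycle V d₀)[(s₀ + m) % (cycle V d₀).length]'(Nat.mod_lt _ (by omega)) =
        (x₀ + (m : ℤ) • dir (k₀ + 1), k₀)) ∧
    (∀ m : ℕ, (m : ℤ) ≤ R - 2 →
      (cycle V d₀)[(s₀ + (cycle V d₀).length * (R - 2).toNat - m) % (cycle V d₀).length]'
        (Nat.mod_lt _ (by omega)) = (x₀ - (m : ℤ) • dir (k₀ + 1), k₀)) := by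
  have hk₀ : x₀ + dir k₀ ∉ V := by
    have h := (s3_dsucc_iterate V s₀).1 d₀ hv₀ ht₀
    rw [← se_cycle_getElem (V := V) hs₀, hds₀] at h
    exact h.2
  have hS := fun (j : ℤ) (hj : -(R - 2) ≤ j) (hj' : j ≤ R - 2) =>
    dsucc_straight hd hflat (by omega) hk₀ hj hj'
  set γ : ℤ → Dart := fun i => (x₀ + i • dir (k₀ + 1), k₀) with hγ
  have h0 : (cycle V d₀)[s₀] = γ 0 := by rw [hds₀, hγ]; simp
  have hsucc : ∀ i : ℤ, 0 - ((R - 2).toNat : ℕ) ≤ i → i < 0 + ((R - 2).toNat : ℕ) →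
      dsucc V (γ i) = γ (i + 1) := fun i hi1 hi2 => (hS i (by omega) (by omega)).2.2
  have hext : ∀ i : ℤ, 0 - ((R - 2).toNat : ℕ) ≤ i → i < 0 →
      (γ i).1 ∈ V ∧ dartTip (γ i) ∉ V := fun i hi1 hi2 =>
    ⟨(hS i (by omega) (by omega)).1, (hS i (by omega) (by omega)).2.1⟩
  constructor
  · intro m hm
    have hf := lc_follow_fwd hv₀ ht₀ γ 0 (R - 2).toNat (fun i hi1 hi2 => hsucc i (by omega) hi2)
      hs₀ h0 m (by omega)
    rw [hf, hγ]; simp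
  · intro m hm
    have hb := lc_follow_bwd hv₀ ht₀ γ 0 (R - 2).toNat (fun i hi1 hi2 => hsucc i hi1 (by omega))
      hext hs₀ h0 m (by omega)
    rw [hb, hγ]; simp [sub_eq_add_neg]

/-! ### Active darts are near insertion points -/

section Admissible

variable (ι : LegInsertionData) (V : Finset (ℤ × ℤ)) {d₀ : Dart} (hadm : ι.IsAdmissible V)
  (h0 : outDart V ι.sink = some d₀) {st : ℕ → WalkState}
  (hst : ∀ t, st t = List.foldl (fun s d => s.step (ι.startAt V d)) ι.init ((cycle V d₀).take t))

include hadm h0 hst in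
/-- **An active dart is within `L - 1` of an insertion point.** If the insertion points are flat
at radius `sinkLegs + Rx`, `Rx ≥ 2`, and dart `t` changes the level or the wiredness, then its vertex
is within sup-distance `sinkLegs - 1` of an insertion point (it is dart `j₀ ≤ L - 1` of that
point's footprint, which runs straight). [folklore] -/
theorem ca_active_near {Rx : ℤ} (hRx : 2 ≤ Rx)
    (hflat : ∀ x ∈ insert ι.sink ι.source, ∃ dvec : ℤ × ℤ,
      (dvec = (1, 0) ∨ dvec = (-1, 0) ∨ dvec = (0, 1) ∨ dvec = (0, -1)) ∧
      ∀ v : ℤ × ℤ, (v.1 - x.1) ^ 2 + (v.2 - x.2) ^ 2 ≤ ((ι.sinkLegs : ℤ) + Rx) ^ 2 →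
        (v ∈ V ↔ 0 ≤ (v.1 - x.1) * dvec.1 + (v.2 - x.2) * dvec.2))
    {t : ℕ} (ht : t < (cycle V d₀).length)
    (hact : ¬ ((st (t + 1)).level = (st t).level ∧ (st (t + 1)).wired = (st t).wired)) :
    ∃ x₀ ∈ insert ι.sink ι.source, |((cycle V d₀)[t]).1.1 - x₀.1| ≤ (ι.sinkLegs : ℤ) - 1 ∧
      |((cycle V d₀)[t]).1.2 - x₀.2| ≤ (ι.sinkLegs : ℤ) - 1 := by
  obtain ⟨hv₀, ht₀⟩ := sinkDart_exterior ι V hadm h0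
  obtain ⟨s₀, hs₀, L₀, σ, hsa, hj₀⟩ := exists_start_of_active ι V hst ht hact
  obtain ⟨hx, -, hL₀⟩ := startAt_eq_some ι V hsa
  have hs₀P : s₀ < (cycle V d₀).length := by omega
  obtain ⟨⟨x₀, k₀⟩, hds₀⟩ : ∃ q : Dart, (cycle V d₀)[s₀] = q := ⟨_, rfl⟩
  rw [hds₀] at hx
  obtain ⟨dvec, hd, hfl⟩ := hflat x₀ hx
  have hrun := (ca_run hv₀ ht₀ hs₀P hds₀ hd hfl (by omega)).1 (t - s₀) (by omega)
  have hidx : (s₀ + (t - s₀)) % (cycle V d₀).length = t := by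
    rw [show s₀ + (t - s₀) = t by omega, Nat.mod_eq_of_lt ht]
  rw [getElem_cycle_congr (Nat.mod_lt _ (by omega)) ht hidx] at hrun
  refine ⟨x₀, hx, ?_⟩
  rw [hrun]
  have hj : ((t - s₀ : ℕ) : ℤ) ≤ (ι.sinkLegs : ℤ) - 1 := by omega
  obtain ⟨a, b⟩ := x₀
  fin_cases k₀ <;> simp [dir] <;> omega

/-! ### Silent stretches -/

/-- A boundary step moves the vertex by at most one in each coordinate. [folklore] -/
theorem ca_step_le_one (d : Dart) :
    |(dsucc V d).1.1 - d.1.1| ≤ 1 ∧ |(dsucc V d).1.2 - d.1.2| ≤ 1 := by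
  obtain ⟨⟨a, b⟩, k⟩ := d
  unfold dsucc
  split_ifs <;> fin_cases k <;> simp [dir]

include hadm h0 in
/-- The vertex of the dart `e` steps after `s` is within sup-distance `e` of the vertex of `ds[s]`.
[folklore] -/
theorem ca_vertex_near {s : ℕ} (hs : s < (cycle V d₀).length) :
    ∀ e : ℕ, |((cycle V d₀)[(s + e) % (cycle V d₀).length]'(Nat.mod_lt _ (by omega))).1.1 -
        ((cycle V d₀)[s]).1.1| ≤ e ∧
      |((cycle V d₀)[(s + e) % (cycle V d₀).length]'(Nat.mod_lt _ (by omega))).1.2 -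
        ((cycle V d₀)[s]).1.2| ≤ e := by
  obtain ⟨hv₀, ht₀⟩ := sinkDart_exterior ι V hadm h0
  intro e
  induction e with
  | zero =>
    rw [getElem_cycle_congr (Nat.mod_lt _ (by omega)) hs (by rw [Nat.add_zero, Nat.mod_eq_of_lt hs])]
    simp
  | succ e ih =>
    have hidx : ((s + e) % (cycle V d₀).length + 1) % (cycle V d₀).length =
        (s + (e + 1)) % (cycle V d₀).length := by rw [Nat.mod_add_mod, Nat.add_assoc]
    rw [← getElem_cycle_congr (Nat.mod_lt _ (by omega)) (Nat.mod_lt _ (by omega)) hidx,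
      cycle_succ hv₀ ht₀ (Nat.mod_lt _ (by omega))]
    have hstep := ca_step_le_one (V := V) ((cycle V d₀)[(s + e) % (cycle V d₀).length]'(Nat.mod_lt _ (by omega)))
    obtain ⟨i1, i2⟩ := ih
    obtain ⟨s1, s2⟩ := hstep
    rw [abs_le] at i1 i2 s1 s2 ⊢
    constructor
    · push_cast; constructor <;> linarith [i1.1, i1.2, s1.1, s1.2]
    · rw [abs_le]; push_cast; constructor <;> linarith [i2.1, i2.2, s2.1, s2.2]

include hadm h0 hst in
/-- **Along consecutive silent darts nothing changes.** If the darts `(s + e) % P`, `e < m`, are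
all silent, the state indexed `(s + m) % P` has the level and the wiredness of `st s`. [folklore] -/
theorem ca_silent_run {s : ℕ} (hs : s < (cycle V d₀).length) :
    ∀ m : ℕ, (∀ e, e < m →
      (st ((s + e) % (cycle V d₀).length + 1)).level = (st ((s + e) % (cycle V d₀).length)).level ∧
      (st ((s + e) % (cycle V d₀).length + 1)).wired = (st ((s + e) % (cycle V d₀).length)).wired) →
      (st ((s + m) % (cycle V d₀).length)).level = (st s).level ∧
      (st ((s + m) % (cycle V d₀).length)).wired = (st s).wired := by
  intro m
  induction m with
  | zero => intro _; rw [Nat.add_zero, Nat.mod_eq_of_lt hs]; exact ⟨rfl, rfl⟩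
  | succ m ih =>
    intro hsil
    obtain ⟨l1, w1⟩ := ih fun e he => hsil e (by omega)
    obtain ⟨l2, w2⟩ := hsil m (by omega)
    have hmod := st_mod_succ ι V hadm h0 hst (t := (s + m) % (cycle V d₀).length) (Nat.mod_lt _ (by omega))
    rw [Nat.mod_add_mod, Nat.add_assoc] at hmod
    rw [hmod.1, hmod.2, l2, w2, l1, w1]
    exact ⟨rfl, rfl⟩

include hadm h0 hst in
/-- **Away from the insertion points the walk is silent.** With insertion points flat at radius
`sinkLegs + Rx` (`Rx ≥ 2`): if no insertion point is within sup-distance `m + sinkLegs - 1` of the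
vertex of `ds[s]`, then the states at `s` and at `s' = (s + m) % P` — before and after either
dart — all carry the level and the wiredness of `st s`. [folklore] -/
theorem ca_levels_eq {Rx : ℤ} (hRx : 2 ≤ Rx)
    (hflat : ∀ x ∈ insert ι.sink ι.source, ∃ dvec : ℤ × ℤ,
      (dvec = (1, 0) ∨ dvec = (-1, 0) ∨ dvec = (0, 1) ∨ dvec = (0, -1)) ∧
      ∀ v : ℤ × ℤ, (v.1 - x.1) ^ 2 + (v.2 - x.2) ^ 2 ≤ ((ι.sinkLegs : ℤ) + Rx) ^ 2 →
        (v ∈ V ↔ 0 ≤ (v.1 - x.1) * dvec.1 + (v.2 - x.2) * dvec.2))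
    {s : ℕ} (hs : s < (cycle V d₀).length) (m : ℕ)
    (hfar : ∀ x₀ ∈ insert ι.sink ι.source,
      (m : ℤ) + ι.sinkLegs ≤ |((cycle V d₀)[s]).1.1 - x₀.1| ∨
        (m : ℤ) + ι.sinkLegs ≤ |((cycle V d₀)[s]).1.2 - x₀.2|)
    {s' : ℕ} (hs' : s' < (cycle V d₀).length) (hss' : s' = (s + m) % (cycle V d₀).length) :
    ((st (s + 1)).level = (st s).level ∧ (st (s + 1)).wired = (st s).wired) ∧
    ((st s').level = (st s).level ∧ (st s').wired = (st s).wired) ∧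
    ((st (s' + 1)).level = (st s).level ∧ (st (s' + 1)).wired = (st s).wired) := by
  -- every dart within `m` steps of `s` is silent
  have hsil : ∀ e, e ≤ m →
      (st ((s + e) % (cycle V d₀).length + 1)).level = (st ((s + e) % (cycle V d₀).length)).level ∧
      (st ((s + e) % (cycle V d₀).length + 1)).wired = (st ((s + e) % (cycle V d₀).length)).wired := by
    intro e he
    by_contra hact
    obtain ⟨x₀, hx₀, h1, h2⟩ := ca_active_near ι V hadm h0 hst hRx hflat (Nat.mod_lt _ (by omega)) hact
    obtain ⟨n1, n2⟩ := ca_vertex_near ι V hadm h0 hs e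
    rw [abs_le] at h1 h2 n1 n2
    rcases hfar x₀ hx₀ with h | h <;> rw [le_abs] at h <;> omega
  have hA := hsil 0 (Nat.zero_le _)
  simp only [Nat.add_zero, Nat.mod_eq_of_lt hs] at hA
  have hB := ca_silent_run ι V hadm h0 hst hs m fun e he => hsil e he.le
  have hC := ca_silent_run ι V hadm h0 hst hs (m + 1) fun e he => hsil e (by omega)
  have hmod := st_mod_succ ι V hadm h0 hst hs'
  subst hss'
  rw [Nat.mod_add_mod, show s + m + 1 = s + (m + 1) by omega] at hmod
  rw [hmod.1, hmod.2] at hC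
  exact ⟨hA, hB, hC⟩

end Admissible

/-! ### Registered one-line form -/

/-- **Registered sub-goal `s17_configsNonempty_part8`** of `s17_eventually_configsNonempty`
(stmt-CriticalPhenomena-14132): for an admissible leg insertion whose insertion points are flat at
radius `sinkLegs + Rx`, `Rx ≥ 2`, every ACTIVE dart of the collar walk has its vertex within
sup-distance `sinkLegs - 1` of an insertion point (one-line form of `ca_active_near`). [folklore] -/
theorem s17_configsNonempty_part8 : ∀ (ι : Literature.Probability.LatticeModels.CollarLegModel.LegInsertionData) (V : Finset (ℤ × ℤ)) (d₀ : Literature.Probability.LatticeModels.CollarLegModel.Dart) (st : ℕ → Literature.Probability.LatticeModels.CollarLegModel.WalkState), ι.IsAdmissible V → Literature.Probability.LatticeModels.CollarLegModel.outDart V ι.sink = some d₀ → (∀ t, st t = List.foldl (fun s d ↦ s.step (ι.startAt V d)) ι.init ((Literature.Probability.LatticeModels.CollarLegModel.cycle V d₀).take t)) → ∀ (Rx : ℤ), 2 ≤ Rx → (∀ x ∈ insert ι.sink ι.source, ∃ dvec : ℤ × ℤ, (dvec = (1, 0) ∨ dvec = (-1, 0) ∨ dvec = (0, 1) ∨ dvec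 = (0, -1)) ∧ ∀ v : ℤ × ℤ, (v.1 - x.1) ^ 2 + (v.2 - x.2) ^ 2 ≤ ((ι.sinkLegs : ℤ) + Rx) ^ 2 → (v ∈ V ↔ 0 ≤ (v.1 - x.1) * dvec.1 + (v.2 - x.2) * dvec.2)) → ∀ (t : ℕ) (ht : t < (Literature.Probability.LatticeModels.CollarLegModel.cycle V d₀).length), ¬ ((st (t + 1)).level = (st t).level ∧ (st (t + 1)).wired = (st t).wired) → ∃ x₀ ∈ insert ι.sink ι.source, |((Literature.Probability.LatticeModels.CollarLegModel.cycle V d₀)[t]).1.1 - x₀.1| ≤ (ι.sinkLegs : ℤ) - 1 ∧ |((Literature.Probability.LatticeModels.CollarLegModel.cycle V d₀)[t]).1.2 - x₀.2| ≤ (ι.sinkLegs : ℤ) - 1 :=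
  fun ι V _ _ hadm h0 hst _ hRx hflat _ ht hact => ca_active_near ι V hadm h0 hst hRx hflat ht hact

end Summit.CriticalPhenomena.CardyFormulaZ2.Cruxes.BoundaryDefectGaussianR.RainbowMonomialsInExcursionKernels
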